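import Literature.IUT.HodgeArakelov.MonoThetaCor110SubdagStatements

/-!
# [IUTchII] Corollary 1.10 — sub-DAG, junction C110-S10 reduced: a functorial family from ONE base datum
# with an `Aut(Π)`-action (statements-first + bookkeeping proofs)

S. Mochizuki, *Inter-universal Teichmüller theory II*, §1, Corollary 1.10, kurims manuscript (Dec. 2020)
p. 47: the data `(Π, (l·Δ_Θ)(Π), Π_μ(M^Θ_*(Π)), (∗mono-Θ_Π))` "determines a functor `ℛ → ℱ` … which arises
from a functorial algorithm in the topological group `Π`" [claim: Mochizuki2012, status: disputed] (IUTchII §1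
Cor 1.10, kurims p.47). abc-iut cell, continuation of `MonoThetaCor110SubdagStatements.lean` (sub-DAG
`plan/L6/SUBDAG-IUTchII-Cor-110.md`, holder abc-iut-w5-d145), row C110-S10.

`MonoThetaCor110SubdagStatements` types the OUTPUT of the composite algorithm as a functorial family
`MonoThetaRigidityData S` over the groupoid `IsoClass Π^tp_{X̲̲_k}` and leaves OPEN the junction C110-S10:
exhibit such a family MODELLING the genuine outputs of Props. 1.2 (i) / 1.4 / 1.5 (iii). This file REDUCES
that junction, by pure bookkeeping (everything PROVED), to two inputs at a SINGLE isomorph `Π₀` of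
`Π^tp_{X̲̲_k}`:

* a BASE DATUM (`MonoThetaBaseDatum S Π₀`): the two `Π₀`-modules and the equivariant isomorphism — at
  `Π₀ = Π_X(M^Θ_*)` these are `(l·Δ_Θ)(M^Θ_*)`, `Π_μ(M^Θ_*)`, the limit rigidity isomorphism of Prop. 1.5
  (iii) with the module structures `ThetaEnvData.ModuleStr` (C110-S8/S9);
* an ACTION `ρ` of the automorphism group `Aut(Π₀)` of the TOPOLOGICAL GROUP `Π₀` on that datum by
  automorphisms of `ℱ` lifting the identity: for every `γ : Π₀ ⥲ Π₀` automorphisms `ρ_A(γ)`, `ρ_B(γ)` of the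
  two modules, `γ`-semilinear, multiplicative in `γ`, and INTERTWINING the rigidity isomorphism
  (`rho_comm`). This is exactly where [EtTh] enters: `ρ_A` = the automorphism induced on `(l·Δ_Θ)` by `γ`
  (Cor. 2.18 (i): the subquotient is group-theoretic — L2 `RigidData.exists_mulEquiv_thetaMod_comp_of_cor218_i`
  gives its shadow on `(l·Δ_Θ) ⊗ ℤ/N` through `thetaMod`), `ρ_B` = the automorphism induced on `Π_μ(M^Θ_*)`
  by lifting `γ` to the mono-theta environments (Cor. 2.18 (iv); the `μ_N`-conjugacy indeterminacy of the
  lift acts trivially on the abelian `Π_μ`), and `rho_comm` = Cor. 2.19 (i) (cyclotomic rigidity: the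
  rigidity isomorphism is compatible with all isomorphisms of mono-theta environments).

From these, `MonoThetaBaseDatum.family` is a `MonoThetaRigidityData S` (the CONSTANT family: every
isomorph `Π` is compared with `Π₀` along a chosen isomorphism `e_Π : Π ⥲ Π₀`, the transport along
`f : Π ⥲ Π*` is `ρ(e_Π⁻¹ ≫ f ≫ e_{Π*})` — functorial because `ρ` is multiplicative, independent of nothing
else), and `MonoThetaBaseDatum.family_models` PROVES the junction predicate `MonoThetaRigidityData.Models`
for it as soon as the base datum is identified (equivariantly, compatibly with `(∗mono-Θ)`) with the genuine
output `(T.D.lDeltaTheta, Sys.extCycLim, T.rigidLim)`. Hence IUTchII:Cor1.10's functor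
(`family.toRigidityFunctor`, C110-S5) with its printed conclusion (C110-S6) is obtained from: a genuine
`ThetaEnvData` (Prop. 1.5 (iii) holder), its `ModuleStr`, and the [EtTh] action `ρ` — no other input.

HONEST FRAMING: definitions and bookkeeping lemmas over the cell's typed interfaces; the [EtTh] inputs are
named above as the SOURCE of `ρ`, not assumed; nothing disputed is asserted; no side is taken on [IUTchIII]
Cor. 3.12; typed ≠ discharged. [cite: MochizukiEtTh2009, Cor 2.18 p.60]; [cite: MochizukiEtTh2009, Cor 2.19(i) p.64].
-/

noncomputable section

namespace Literature.IUT.HodgeArakelov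

open CategoryTheory

universe u

variable {S : ThetaSetting.{u}}

/-- **IUTchII:Cor1.10**, sub-node C110-S10a: a BASE DATUM for the functorial family at one isomorph `Π₀` of
`Π^tp_{X̲̲_k}` — the two `Π₀`-modules `(l·Δ_Θ)(Π₀)`, `Π_μ(M^Θ_*(Π₀))`, the `Π₀`-equivariant isomorphism
`(∗mono-Θ_{Π₀})`, TOGETHER WITH the action `ρ` of the automorphisms `γ : Π₀ ⥲ Π₀` of the topological group
`Π₀` on both modules ("functorial group-theoretic algorithm": [EtTh] Cor. 2.18 (i) for `(l·Δ_Θ)`, Cor. 2.18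
(iv) for `Π_μ`), `γ`-semilinear, multiplicative in `γ`, and compatible with `(∗mono-Θ)` ([EtTh] Cor. 2.19 (i)).
[claim: Mochizuki2012, status: disputed] (IUTchII §1 Cor 1.10, kurims p.47) -/
structure MonoThetaBaseDatum (S : ThetaSetting.{u}) (P₀ : IsoClass S.PiX) : Type (u + 1) where
  /-- `(l·Δ_Θ)(Π₀)` -/
  A : CommGrpCat.{u}
  /-- `Π_μ(M^Θ_*(Π₀))` -/
  B : CommGrpCat.{u}
  /-- the natural `Π₀`-actions -/
  actA : P₀.G →* MulAut A
  actB : P₀.G →* MulAut B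
  /-- `(∗mono-Θ_{Π₀})` -/
  iso : A ≃* B
  equivariant : ∀ (x : P₀.G) (m : A), iso (actA x m) = actB x (iso m)
  /-- the automorphism of `(l·Δ_Θ)(Π₀)` induced by `γ ∈ Aut(Π₀)` -/
  rhoA : (P₀.G ≃ₜ* P₀.G) → (A ≃* A)
  /-- the automorphism of `Π_μ(M^Θ_*(Π₀))` induced by `γ ∈ Aut(Π₀)` -/
  rhoB : (P₀.G ≃ₜ* P₀.G) → (B ≃* B)
  rhoA_refl : rhoA (ContinuousMulEquiv.refl P₀.G) = MulEquiv.refl A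
  rhoB_refl : rhoB (ContinuousMulEquiv.refl P₀.G) = MulEquiv.refl B
  rhoA_trans : ∀ γ δ : P₀.G ≃ₜ* P₀.G, rhoA (γ.trans δ) = (rhoA γ).trans (rhoA δ)
  rhoB_trans : ∀ γ δ : P₀.G ≃ₜ* P₀.G, rhoB (γ.trans δ) = (rhoB γ).trans (rhoB δ)
  /-- `ρ(γ)` is `γ`-semilinear -/
  rhoA_act : ∀ (γ : P₀.G ≃ₜ* P₀.G) (x : P₀.G) (m : A), rhoA γ (actA x m) = actA (γ x) (rhoA γ m)
  rhoB_act : ∀ (γ : P₀.G ≃ₜ* P₀.G) (x : P₀.G) (m : B), rhoB γ (actB x m) = actB (γ x) (rhoB γ m)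
  /-- `ρ(γ)` intertwines `(∗mono-Θ)` (cyclotomic rigidity, [EtTh] Cor. 2.19 (i)) -/
  rho_comm : ∀ (γ : P₀.G ≃ₜ* P₀.G) (m : A), iso (rhoA γ m) = rhoB γ (iso m)

namespace MonoThetaBaseDatum

variable {P₀ : IsoClass S.PiX} (X : MonoThetaBaseDatum S P₀)

/-- `ρ_A(γ⁻¹) = ρ_A(γ)⁻¹` (PROVED from multiplicativity).
[claim: Mochizuki2012, status: disputed] (IUTchII §1 Cor 1.10, kurims p.47) -/
theorem rhoA_symm (γ : P₀.G ≃ₜ* P₀.G) : X.rhoA γ.symm = (X.rhoA γ).symm := by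
  have h : (X.rhoA γ).trans (X.rhoA γ.symm) = MulEquiv.refl _ := by
    rw [← X.rhoA_trans, show γ.trans γ.symm = ContinuousMulEquiv.refl P₀.G from
      ContinuousMulEquiv.ext fun x => γ.symm_apply_apply x, X.rhoA_refl]
  refine MulEquiv.ext fun m => ?_
  have hm := MulEquiv.congr_fun h ((X.rhoA γ).symm m)
  rw [MulEquiv.trans_apply, MulEquiv.apply_symm_apply, MulEquiv.refl_apply] at hm
  exact hm

/-- `ρ_B(γ⁻¹) = ρ_B(γ)⁻¹` (PROVED). [claim: Mochizuki2012, status: disputed] (IUTchII §1 Cor 1.10, kurims p.47) -/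
theorem rhoB_symm (γ : P₀.G ≃ₜ* P₀.G) : X.rhoB γ.symm = (X.rhoB γ).symm := by
  have h : (X.rhoB γ).trans (X.rhoB γ.symm) = MulEquiv.refl _ := by
    rw [← X.rhoB_trans, show γ.trans γ.symm = ContinuousMulEquiv.refl P₀.G from
      ContinuousMulEquiv.ext fun x => γ.symm_apply_apply x, X.rhoB_refl]
  refine MulEquiv.ext fun m => ?_
  have hm := MulEquiv.congr_fun h ((X.rhoB γ).symm m)
  rw [MulEquiv.trans_apply, MulEquiv.apply_symm_apply, MulEquiv.refl_apply] at hm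
  exact hm

/-- A chosen comparison isomorphism `e_Π : Π ⥲ Π₀` for every isomorph `Π` of `Π^tp_{X̲̲_k}` (both are
isomorphs, `IsoClass.nonempty_hom`). The family below does not depend on the choice up to the canonical
isomorphism `ρ`. [claim: Mochizuki2012, status: disputed] (IUTchII §1 Cor 1.10, kurims p.47) -/
def cmp (P₀ P : IsoClass S.PiX) : P.G ≃ₜ* P₀.G := (IsoClass.nonempty_hom P P₀).some

/-- The automorphism of `Π₀` attached to `f : Π ⥲ Π*`: `e_Π⁻¹ ≫ f ≫ e_{Π*}`.
[claim: Mochizuki2012, status: disputed] (IUTchII §1 Cor 1.10, kurims p.47) -/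
def loopOf (P₀ : IsoClass S.PiX) {P Q : IsoClass S.PiX} (f : P ⟶ Q) : P₀.G ≃ₜ* P₀.G :=
  (cmp P₀ P).symm.trans ((IsoClass.homIso f).trans (cmp P₀ Q))

/-- `loopOf (𝟙 Π) = id`. [claim: Mochizuki2012, status: disputed] (IUTchII §1 Cor 1.10, kurims p.47) -/
theorem loopOf_id (P₀ P : IsoClass S.PiX) : loopOf P₀ (𝟙 P) = ContinuousMulEquiv.refl P₀.G :=
  ContinuousMulEquiv.ext fun x => by
    change cmp P₀ P ((cmp P₀ P).symm x) = x
    exact (cmp P₀ P).apply_symm_apply x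

/-- `loopOf (f ≫ g) = loopOf f ≫ loopOf g`. [claim: Mochizuki2012, status: disputed] (IUTchII §1 Cor 1.10, kurims p.47) -/
theorem loopOf_comp (P₀ : IsoClass S.PiX) {P Q R : IsoClass S.PiX} (f : P ⟶ Q) (g : Q ⟶ R) :
    loopOf P₀ (f ≫ g) = (loopOf P₀ f).trans (loopOf P₀ g) :=
  ContinuousMulEquiv.ext fun x => by
    change cmp P₀ R (IsoClass.homIso g (IsoClass.homIso f ((cmp P₀ P).symm x))) =
      cmp P₀ R (IsoClass.homIso g ((cmp P₀ Q).symm (cmp P₀ Q (IsoClass.homIso f ((cmp P₀ P).symm x)))))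
    rw [ContinuousMulEquiv.symm_apply_apply]

/-- `loopOf f (e_Π x) = e_{Π*} (f x)`. [claim: Mochizuki2012, status: disputed] (IUTchII §1 Cor 1.10, kurims p.47) -/
theorem loopOf_apply_cmp (P₀ : IsoClass S.PiX) {P Q : IsoClass S.PiX} (f : P ⟶ Q) (x : P.G) :
    loopOf P₀ f (cmp P₀ P x) = cmp P₀ Q (IsoClass.homIso f x) := by
  change cmp P₀ Q (IsoClass.homIso f ((cmp P₀ P).symm (cmp P₀ P x))) = _
  rw [ContinuousMulEquiv.symm_apply_apply]

/-- **IUTchII:Cor1.10**, sub-node C110-S10a — THE FUNCTORIAL FAMILY FROM A BASE DATUM WITH `Aut(Π)`-ACTION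
(DEFINED, all laws PROVED): constant modules, actions pulled back along `e_Π`, transports `ρ(e_Π⁻¹ ≫ f ≫ e_{Π*})`,
`(∗mono-Θ_Π) := (∗mono-Θ_{Π₀})`. [claim: Mochizuki2012, status: disputed] (IUTchII §1 Cor 1.10, kurims p.47) -/
def family : MonoThetaRigidityData S where
  intCyc _ := X.A
  extCyc _ := X.B
  actInt P := X.actA.comp (cmp P₀ P).toMulEquiv.toMonoidHom
  actExt P := X.actB.comp (cmp P₀ P).toMulEquiv.toMonoidHom
  monoTheta _ := X.iso
  monoTheta_equivariant P x m := X.equivariant (cmp P₀ P x) m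
  mapInt f := X.rhoA (loopOf P₀ f)
  mapInt_id P := by
    rw [loopOf_id, X.rhoA_refl]
  mapInt_comp f g := by
    rw [loopOf_comp, X.rhoA_trans]
  mapExt f := X.rhoB (loopOf P₀ f)
  mapExt_id P := by
    rw [loopOf_id, X.rhoB_refl]
  mapExt_comp f g := by
    rw [loopOf_comp, X.rhoB_trans]
  mapInt_act f x m := by
    change X.rhoA (loopOf P₀ f) (X.actA (cmp P₀ _ x) m) = X.actA (cmp P₀ _ (IsoClass.homIso f x)) _
    rw [X.rhoA_act, loopOf_apply_cmp]
  mapExt_act f x m := by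
    change X.rhoB (loopOf P₀ f) (X.actB (cmp P₀ _ x) m) = X.actB (cmp P₀ _ (IsoClass.homIso f x)) _
    rw [X.rhoB_act, loopOf_apply_cmp]
  monoTheta_natural f m := X.rho_comm (loopOf P₀ f) m

/-- The family's modules are the base modules (definitionally). [claim: Mochizuki2012, status: disputed] (IUTchII §1 Cor 1.10, kurims p.47) -/
theorem family_intCyc (P : IsoClass S.PiX) : X.family.intCyc P = X.A := rfl

/-- Idem for `Π_μ`. [claim: Mochizuki2012, status: disputed] (IUTchII §1 Cor 1.10, kurims p.47) -/
theorem family_extCyc (P : IsoClass S.PiX) : X.family.extCyc P = X.B := rfl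

/-- The family's `(∗mono-Θ_Π)` is the base isomorphism. [claim: Mochizuki2012, status: disputed] (IUTchII §1 Cor 1.10, kurims p.47) -/
theorem family_monoTheta (P : IsoClass S.PiX) : X.family.monoTheta P = X.iso := rfl

/-- The family's transport along `f` is `ρ_A(e_Π⁻¹ ≫ f ≫ e_{Π*})`. [claim: Mochizuki2012, status: disputed] (IUTchII §1 Cor 1.10, kurims p.47) -/
theorem family_mapInt {P Q : IsoClass S.PiX} (f : P ⟶ Q) : X.family.mapInt f = X.rhoA (loopOf P₀ f) := rfl

/-- **IUTchII:Cor1.10** for the family of a base datum: the functor `ℛ → ℱ` (C110-S5) and its printed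
conclusion "`Ψ_ℛ : ℛ → ℛ†` is multiradially defined" (C110-S6), PROVED.
[claim: Mochizuki2012, status: disputed] (IUTchII §1 Cor 1.10, kurims p.47) -/
theorem cor110_multiradiallyDefined_ofBase (Γxμ : Type u) [Group Γxμ] :
    ((ex18iii S Γxμ).toDagger
      (CategoryTheory.Prod.fst _ _ ⋙ X.family.toRigidityFunctor.Ξ)).IsMultiradiallyDefined :=
  X.family.cor110_multiradiallyDefined_ofData Γxμ

/-- **IUTchII:Cor1.10**, the junction C110-S10 DISCHARGED RELATIVE TO THE BASE DATUM (PROVED): if the base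
datum at `Π₀ := Π_X(M^Θ_*)` is identified — `Π₀`-equivariantly and compatibly with the rigidity isomorphisms
— with the genuine output `((l·Δ_Θ)(M^Θ_*), Π_μ(M^Θ_*), rigidLim)` of Prop. 1.5 (iii) carrying the module
structures `A`, then the family `X.family` MODELS that output (`MonoThetaRigidityData.Models`). So the
remaining content of the node is: a genuine `ThetaEnvData` + `ModuleStr` (C110-S8) and the `Aut(Π₀)`-action
`ρ` on it ([EtTh] Cor. 2.18 (i)/(iv), 2.19 (i)).
[claim: Mochizuki2012, status: disputed] (IUTchII §1 Cor 1.10, kurims p.47) -/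
theorem family_models {F : ModelFamily S} {Sys : MonoThetaProjSystem F} (T : ThetaEnvData Sys)
    (Act : T.ModuleStr) (X : MonoThetaBaseDatum S ⟨Sys.PiX, T.D.isoRef⟩)
    (a₀ : X.A ≃* T.D.lDeltaTheta.carrier) (b₀ : X.B ≃* Sys.extCycLim)
    (ha : ∀ (x : Sys.PiX) (m : X.A), a₀ (X.actA x m) = Act.actInt x (a₀ m))
    (hb : ∀ (x : Sys.PiX) (m : X.B), b₀ (X.actB x m) = Act.actExt x (b₀ m))
    (hab : ∀ m : X.A, T.rigidLim (a₀ m) = b₀ (X.iso m)) :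
    X.family.Models T Act := by
  let P₀ : IsoClass S.PiX := ⟨Sys.PiX, T.D.isoRef⟩
  let e : P₀.G ≃ₜ* P₀.G := cmp P₀ P₀
  refine ⟨(X.rhoA e).symm.trans a₀, (X.rhoB e).symm.trans b₀, fun x m => ?_, fun x m => ?_, fun m => ?_⟩
  · change a₀ ((X.rhoA e).symm (X.actA (e x) m)) = Act.actInt x (a₀ ((X.rhoA e).symm m))
    rw [← X.rhoA_symm, X.rhoA_act, ContinuousMulEquiv.symm_apply_apply, ha]
  · change b₀ ((X.rhoB e).symm (X.actB (e x) m)) = Act.actExt x (b₀ ((X.rhoB e).symm m))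
    rw [← X.rhoB_symm, X.rhoB_act, ContinuousMulEquiv.symm_apply_apply, hb]
  · change T.rigidLim (a₀ ((X.rhoA e).symm m)) = b₀ ((X.rhoB e).symm (X.iso m))
    rw [← X.rhoA_symm, ← X.rhoB_symm, hab, X.rho_comm]

end MonoThetaBaseDatum

end Literature.IUT.HodgeArakelov
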